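import Summits.BirchSwinnertonDyer.BirchSwinnertonDyer.Theorems.SylvesterTwoHeegnerIndexCMHalfInvolutionFixingBottomOfLevel
import Summits.BirchSwinnertonDyer.BirchSwinnertonDyer.Theorems.SylvesterTwoHeegnerIndexCMHalfTransversal
import HarnessLib

/-!
# The COUPLED Cassels–Tate telescope, RESIDUE 7′ (VARIANT Q): the HALVED-SYSTEM CHOICES — the bottom involution `s`, a
# half `H′`, the half fixer `N″` with its transversal, and the LEVEL INVOLUTIONS `φ n` at EVERY conductor `9pn`, FROM
# THE REGISTERED (W2-b) DISPLAY (crux `UpperOffV0HSYPlus`, stmt-BirchSwinnertonDyer-19804)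

Skeleton VARIANT Q `Cruxes/UpperOffV0HSYPlus/Lines/coupled_variantQ.lean` d342db51dc602551, stub `stub_residueSevenHalved`;
planner D789/D793 (H-A … H-F consume these data as binders).  This file is the `p ≡ 7 (9)` analogue of S4a
`…ClassSystemChoices` for the data the HALVED class-term files add to RESIDUE 4's: given the bottom frame of the class
system (coherent embeddings `emb`, the cube roots `c₃, c_p ∈ K[9p]`, their stabiliser `H` with lifts `T` and product
representatives `t` of `Γ_K/N₀` — `exists_bottom_transversal`; the coupled frame's `v_B, v_A`), HSY's CM points `y₁`,
`y n`, and THE TOWER FIXING in the registered ∀-form `hW2b` (= `stub_levelFixingSeven Dt hdeg` VERBATIM: every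
`τ ∈ Γ_{K_v}`, `v ∋ 3`, acting on an embedded `K[9pn]` as an involution fixes `y_n`), it CHOOSES ONCE:
the bottom involution `s ∈ H` (`s ≠ 1`, `s² = 1`, `s·y₁ = y₁`) and the level involutions `φ n` (restricting to `s`, fixing
`y n`, `φ n² = 1`, realised at `w ∋ 3` by some `τ₀ ∈ Γ_{K_w}`) — #S10c `SylvesterTwoCMHalf.decompFixing_of_involutionFixing`
with #S10e `involutionFixing_bottom_of_level`, made into a FUNCTION of `n` by choice; a half `H′` of `H` (CMHalf prep
`exists_half`); and the half fixer `N″ ⊇ N₀` with the dichotomy, fixing `v_B, v_A`, the half family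
`(q, h′) ↦ t (q, h′)` BIJECTIVE onto `Γ_K ⧸ N″` (CMHalf #S3 `exists_halfFixer`).  These are exactly the extra binders of H-A
`levelDataHalved_sylvesterTower`, H-B `selmerAway_of_recipe_prime_halved`, H-D `bottomLink_halved_sylvesterPair`, H-E
`exists_classSystemHalved_sylvesterPair`, H-F `classSystemHalved_flip_sylvesterPair`.
* ★ `exists_halvedChoices_sylvesterTower`.
Theorems only (no definition / named fact / instance / notation); CONDITIONAL on the displayed (W2-b) hypothesis `hW2b`
(cell lemma, unrefereed; registered stub `stub_levelFixingSeven`, never restated weaker); nothing asserted on 19804; no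
stub closed on the ledger; X12.CMAtTwo NOT proved; BSD not claimed for any curve.  Sources: [GrossLMS1991] §3 (3.3)–(3.4),
§4 (4.1); [HuShuYin2019] §2 Prop. 2.4, §4.1 p. 10; [NeukirchANT1999] Ch. II §9 Prop. (9.6); memo g44 §2 (F2), §4.
`lean search 'halvedChoices'` → nothing before this file.
-/

set_option linter.dupNamespace false -- Summits modules are `Summit.<Summit>.<Problem>…` by design
set_option autoImplicit false

noncomputable section

open scoped Classical Pointwise

namespace Summit.BirchSwinnertonDyer.BirchSwinnertonDyer.Theorems.SylvesterTwoCMHalf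

open WeierstrassCurve Field NumberField IsDedekindDomain Finset
open Literature.NumberTheory.EllipticCurves Literature.NumberTheory.GaloisRepresentations
  Literature.NumberTheory.EllipticCurves.ModularForms
  Literature.NumberTheory.EllipticCurves.HuShuYin2019
  Literature.NumberTheory.EllipticCurves.KolyvaginCocycle
  Literature.NumberTheory.EllipticCurves.RingClassField
  Summit.BirchSwinnertonDyer.BirchSwinnertonDyer.Theorems.SylvesterTwoCMData
  Summit.BirchSwinnertonDyer.BirchSwinnertonDyer.Theorems.SylvesterTwoCMFlip
  Summit.BirchSwinnertonDyer.Rank1Residual.X11b Summit.BirchSwinnertonDyer.Rank1Residual.X11b.RingClassTower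

variable {K : Type} [Field K] [NumberField K]

set_option maxHeartbeats 1600000 in
/-- ★ **THE HALVED-SYSTEM CHOICES from the registered (W2-b) display.**  For `p ≡ 7 (9)`, `K ∋ ω` quadratic, a degree-6
`Dt`, coherent embeddings `emb`, the bottom frame (`c₃, c_p`, `H`, `T`, `t`, `N₀`), cube roots `v_B, v_A ∈ K̄` of `p/9`,
`p²/3`, HSY's `y₁` and a family `y n` of CM points of conductor `9pn`, and `hW2b` (= `stub_levelFixingSeven Dt hdeg`):
there are `s ∈ H`, a half `H′` of `H`, `N″ ≤ Γ_K` and a family `φ : (n : ℕ) → Aut_K K[9pn]` with: `s ≠ 1`, `s² = 1`,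
`s·y₁ = y₁`; `∀ h, Xor (h ∈ H′) (h s ∈ H′)`; `N₀ ≤ N″`, the dichotomy, every lift of `s` lies in `N″`, `N″` fixes `v_B, v_A`, the half family is
bijective onto `Γ_K ⧸ N″`; and for every `n ≠ 0` with all prime factors `≡ 2 (3)`: `φ n` restricts to `s` along every inclusion,
fixes `y n`, `φ n * φ n = 1`, and is realised at every `w ∋ 3` by some `τ₀ ∈ Γ_{K_w}` on `emb (9pn)`.
[cite: GrossLMS1991, §3 (3.3)–(3.4), §4 (4.1)] [cite: HuShuYin2019, §2 Prop. 2.4, §4.1 p. 10]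
[cite: NeukirchANT1999, Ch. II §9 Prop. (9.6)] -/
theorem exists_halvedChoices_sylvesterTower
    (Dt : ModularParametrizationData (⟨0, 0, 1, 0, -1⟩ : WeierstrassCurve ℚ) 243)
    (hW2b : ∀ (p : ℕ), p.Prime → p % 9 = 7 → ∀ (K : Type) [Field K] [NumberField K] (ω : K), ω ^ 2 + ω + 1 = 0 →
      Module.finrank ℚ K = 2 → ∀ (ι : K →+* ℂ) (v : HeightOneSpectrum (𝓞 K)), ((3 : ℕ) : 𝓞 K) ∈ v.asIdeal →
      ∀ (n : ℕ), n ≠ 0 → (∀ q ∈ n.primeFactors, q % 3 = 2) →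
      ∀ (e : ringClassField K ι (9 * p * n) →+* AlgebraicClosure K),
        (∀ k : K, e (algebraMap K (ringClassField K ι (9 * p * n)) k) = algebraMap K (AlgebraicClosure K) k) →
      ∀ (y : ((⟨0, 0, 1, 0, -1⟩ : WeierstrassCurve ℚ).baseChange (ringClassField K ι (9 * p * n))).toAffine.Point),
        Affine.Point.map (W' := (⟨0, 0, 1, 0, -1⟩ : WeierstrassCurve ℚ)) (ringClassField K ι (9 * p * n)).subtype.toRatAlgHom y =
          Dt.φ (heegnerTau ((n : ℤ) ^ 2 * (81 * ((p : ℤ) ^ 2 + 4 * p + 16)),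
            (n : ℤ) * (-(9 * (4 * (p : ℤ) ^ 2 + 17 * p + 72))), 4 * (p : ℤ) ^ 2 + 18 * p + 81)) →
      ∀ (τ : absoluteGaloisGroup (v.adicCompletion K))
        (φ : ringClassField K ι (9 * p * n) ≃ₐ[K] ringClassField K ι (9 * p * n)),
        (∀ x : ringClassField K ι (9 * p * n), (show AlgebraicClosure K ≃ₐ[K] AlgebraicClosure K from
          resGal (K := K) (v.adicCompletion K) τ) (e x) = e (φ x)) → φ * φ = 1 →
        pointGalHom (⟨0, 0, 1, 0, -1⟩ : WeierstrassCurve ℚ) (ringClassField K ι (9 * p * n)) (φ.restrictScalars ℚ) y = y)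
    {p : ℕ} (hp : p.Prime) (h9 : p % 9 = 7) {ω : K} (hω : ω ^ 2 + ω + 1 = 0) (h2 : Module.finrank ℚ K = 2) (ι : K →+* ℂ)
    (emb : (m : ℕ) → (ringClassField K ι m →+* AlgebraicClosure K))
    (hemb : ∀ (m : ℕ) (k : K), emb m (algebraMap K (ringClassField K ι m) k) = algebraMap K (AlgebraicClosure K) k)
    {vB vA : AlgebraicClosure K} (hvBc : vB ^ 3 = algebraMap ℚ (AlgebraicClosure K) ((p : ℚ) / 9))
    (hvAc : vA ^ 3 = algebraMap ℚ (AlgebraicClosure K) ((p : ℚ) ^ 2 / 3))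
    (N₀ : Subgroup (absoluteGaloisGroup K))
    (hN₀ : ∀ g : absoluteGaloisGroup K, g ∈ N₀ ↔
      ∀ x : ringClassField K ι (9 * p), (show AlgebraicClosure K ≃ₐ[K] AlgebraicClosure K from g) (emb (9 * p) x) = emb (9 * p) x)
    {c₃ cp : ringClassField K ι (9 * p)} (hc₃ : c₃ ^ 3 = 3) (hcp : cp ^ 3 = (p : ringClassField K ι (9 * p)))
    (H : Subgroup (ringClassField K ι (9 * p) ≃ₐ[K] ringClassField K ι (9 * p)))
    (hH : ∀ σ, σ ∈ H ↔ σ c₃ = c₃ ∧ σ cp = cp) [Fintype H]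
    (T : (ringClassField K ι (9 * p) ≃ₐ[K] ringClassField K ι (9 * p)) → absoluteGaloisGroup K)
    (hT : ∀ σ (x : ringClassField K ι (9 * p)),
      (show AlgebraicClosure K ≃ₐ[K] AlgebraicClosure K from T σ) (emb (9 * p) x) = emb (9 * p) (σ x))
    (t : ((ringClassField K ι (9 * p) ≃ₐ[K] ringClassField K ι (9 * p)) ⧸ H) × H → absoluteGaloisGroup K)
    (ht' : ∀ q h, t (q, h) = T (Quotient.out q) * T (h : _))
    (y₁ : ((⟨0, 0, 1, 0, -1⟩ : WeierstrassCurve ℚ).baseChange (ringClassField K ι (9 * p))).toAffine.Point)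
    (hy₁ : Affine.Point.map (W' := (⟨0, 0, 1, 0, -1⟩ : WeierstrassCurve ℚ))
        (ringClassField K ι (9 * p)).subtype.toRatAlgHom y₁ =
      Dt.φ (heegnerTau (81 * ((p : ℤ) ^ 2 + 4 * p + 16), -(9 * (4 * (p : ℤ) ^ 2 + 17 * p + 72)),
        4 * (p : ℤ) ^ 2 + 18 * p + 81)))
    (y : (n : ℕ) → ((⟨0, 0, 1, 0, -1⟩ : WeierstrassCurve ℚ).baseChange (ringClassField K ι (9 * p * n))).toAffine.Point)
    (hy : ∀ n, n ≠ 0 → (∀ q ∈ n.primeFactors, q % 3 = 2) →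
      Affine.Point.map (W' := (⟨0, 0, 1, 0, -1⟩ : WeierstrassCurve ℚ)) (ringClassField K ι (9 * p * n)).subtype.toRatAlgHom (y n) =
        Dt.φ (heegnerTau ((n : ℤ) ^ 2 * (81 * ((p : ℤ) ^ 2 + 4 * p + 16)),
          (n : ℤ) * (-(9 * (4 * (p : ℤ) ^ 2 + 17 * p + 72))), 4 * (p : ℤ) ^ 2 + 18 * p + 81))) :
    ∃ (s : H) (H' : Finset H) (N'' : Subgroup (absoluteGaloisGroup K))
      (φ : (n : ℕ) → (ringClassField K ι (9 * p * n) ≃ₐ[K] ringClassField K ι (9 * p * n))),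
      (s : ringClassField K ι (9 * p) ≃ₐ[K] ringClassField K ι (9 * p)) ≠ 1 ∧ s * s = 1 ∧
      pointGalHom (⟨0, 0, 1, 0, -1⟩ : WeierstrassCurve ℚ) (ringClassField K ι (9 * p))
        ((s : _ ≃ₐ[K] _).restrictScalars ℚ) y₁ = y₁ ∧
      (∀ h : H, Xor (h ∈ H') (h * s ∈ H')) ∧
      (∀ g ∈ N₀, g ∈ N'') ∧
      (∀ g ∈ N'', (∀ x : ringClassField K ι (9 * p),
          (show AlgebraicClosure K ≃ₐ[K] AlgebraicClosure K from g) (emb (9 * p) x) = emb (9 * p) x) ∨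
        (∀ x : ringClassField K ι (9 * p),
          (show AlgebraicClosure K ≃ₐ[K] AlgebraicClosure K from g) (emb (9 * p) x) =
            emb (9 * p) ((s : ringClassField K ι (9 * p) ≃ₐ[K] ringClassField K ι (9 * p)) x))) ∧
      (∀ g : absoluteGaloisGroup K, (∀ x : ringClassField K ι (9 * p),
          (show AlgebraicClosure K ≃ₐ[K] AlgebraicClosure K from g) (emb (9 * p) x) =
            emb (9 * p) ((s : ringClassField K ι (9 * p) ≃ₐ[K] ringClassField K ι (9 * p)) x)) → g ∈ N'') ∧
      (∀ g ∈ N'', (show AlgebraicClosure K ≃ₐ[K] AlgebraicClosure K from g) vB = vB) ∧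
      (∀ g ∈ N'', (show AlgebraicClosure K ≃ₐ[K] AlgebraicClosure K from g) vA = vA) ∧
      (Function.Bijective fun i : ((ringClassField K ι (9 * p) ≃ₐ[K] ringClassField K ι (9 * p)) ⧸ H) × H' ↦
        (t (i.1, (i.2 : H)) : absoluteGaloisGroup K ⧸ N'')) ∧
      (∀ n, n ≠ 0 → (∀ q ∈ n.primeFactors, q % 3 = 2) →
        ∀ (hle : ringClassField K ι (9 * p) ≤ ringClassField K ι (9 * p * n)) (x : ringClassField K ι (9 * p)),
          φ n (RingClassField.inclusion ι hle x) =
            RingClassField.inclusion ι hle ((s : ringClassField K ι (9 * p) ≃ₐ[K] ringClassField K ι (9 * p)) x)) ∧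
      (∀ n, n ≠ 0 → (∀ q ∈ n.primeFactors, q % 3 = 2) →
        pointGalHom (⟨0, 0, 1, 0, -1⟩ : WeierstrassCurve ℚ) (ringClassField K ι (9 * p * n)) ((φ n).restrictScalars ℚ) (y n) = y n) ∧
      (∀ n, n ≠ 0 → (∀ q ∈ n.primeFactors, q % 3 = 2) → φ n * φ n = 1) ∧
      (∀ n, n ≠ 0 → (∀ q ∈ n.primeFactors, q % 3 = 2) →
        ∀ w : HeightOneSpectrum (𝓞 K), ((3 : ℕ) : 𝓞 K) ∈ w.asIdeal →
          ∃ τ₀ : absoluteGaloisGroup (w.adicCompletion K), ∀ x : ringClassField K ι (9 * p * n),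
            (show AlgebraicClosure K ≃ₐ[K] AlgebraicClosure K from resGal (K := K) (w.adicCompletion K) τ₀) (emb (9 * p * n) x) =
              emb (9 * p * n) (φ n x)) := by
  have hK := JZero.isImaginaryQuadratic_of_sq_add_self_add_one hω h2
  have hp0 : p ≠ 0 := hp.ne_zero
  have h9p : 9 * p ≠ 0 := mul_ne_zero (by norm_num) hp0
  -- ### the bottom involution `s` and the level involutions, from (W2-b) through #S10c/#S10e
  obtain ⟨s, hs1, hs2, hs3, hsp, hsy, hlev⟩ :=
    decompFixing_of_involutionFixing Dt (involutionFixing_bottom_of_level Dt hW2b) hW2b p hp h9 K ω hω h2 ι c₃ cp hc₃ hcp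
      y₁ hy₁
  have hsH : s ∈ H := (hH s).mpr ⟨hs3, hsp⟩
  -- ### a half `H′` of `H` (coset representatives of `⟨s⟩`)
  have hs1' : (⟨s, hsH⟩ : H) ≠ 1 := fun h ↦ hs1 (congrArg Subtype.val h)
  have hs2' : (⟨s, hsH⟩ : H) * ⟨s, hsH⟩ = 1 := Subtype.ext hs2
  obtain ⟨H', hH'⟩ := exists_half (⟨s, hsH⟩ : H) hs1' hs2'
  -- ### the half fixer `N″` and the bijectivity of the half family
  obtain ⟨N'', hle'', hdich, hlift, hN''vB, hN''vA, ht''⟩ := exists_halfFixer hω h2 ι hp0 hvBc hvAc (emb (9 * p)) (hemb _)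
    N₀ hN₀ hc₃ hcp H hH T hT t ht' ⟨s, hsH⟩ hs2' H' hH'
  -- ### the level involutions as a function of `n` (choice on #S10c's ∃)
  have hle : ∀ n, n ≠ 0 → ringClassField K ι (9 * p) ≤ ringClassField K ι (9 * p * n) := fun n hn ↦
    ringClassField_mono hK ι (dvd_mul_right (9 * p) n) (mul_ne_zero h9p hn)
  have key : ∀ n, n ≠ 0 → (∀ q ∈ n.primeFactors, q % 3 = 2) →
      ∃ φ : ringClassField K ι (9 * p * n) ≃ₐ[K] ringClassField K ι (9 * p * n),
        (∀ (hle : ringClassField K ι (9 * p) ≤ ringClassField K ι (9 * p * n)) (x : ringClassField K ι (9 * p)),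
          φ (RingClassField.inclusion ι hle x) = RingClassField.inclusion ι hle (s x)) ∧
        pointGalHom (⟨0, 0, 1, 0, -1⟩ : WeierstrassCurve ℚ) (ringClassField K ι (9 * p * n)) (φ.restrictScalars ℚ) (y n) = y n ∧
        φ * φ = 1 ∧
        ∀ w : HeightOneSpectrum (𝓞 K), ((3 : ℕ) : 𝓞 K) ∈ w.asIdeal →
          ∃ τ₀ : absoluteGaloisGroup (w.adicCompletion K), ∀ x : ringClassField K ι (9 * p * n),
            (show AlgebraicClosure K ≃ₐ[K] AlgebraicClosure K from resGal (K := K) (w.adicCompletion K) τ₀) (emb (9 * p * n) x) =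
              emb (9 * p * n) (φ x) := by
    intro n hn hq
    obtain ⟨φ, hφs, hφy, hφ2, hφτ⟩ := hlev n hn hq (hle n hn) (emb (9 * p * n)) (hemb _) (y n) (hy n hn hq)
    exact ⟨φ, fun hle' x ↦ hφs x, hφy, hφ2, hφτ⟩
  refine ⟨⟨s, hsH⟩, H', N'', fun n ↦ if h : n ≠ 0 ∧ (∀ q ∈ n.primeFactors, q % 3 = 2) then (key n h.1 h.2).choose else 1,
    hs1, hs2', hsy, hH', hle'', hdich, hlift, hN''vB, hN''vA, ht'', ?_, ?_, ?_, ?_⟩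
  · intro n hn hq hle' x
    simp only [dif_pos (show n ≠ 0 ∧ (∀ q ∈ n.primeFactors, q % 3 = 2) from ⟨hn, hq⟩)]
    exact (key n hn hq).choose_spec.1 hle' x
  · intro n hn hq
    simp only [dif_pos (show n ≠ 0 ∧ (∀ q ∈ n.primeFactors, q % 3 = 2) from ⟨hn, hq⟩)]
    exact (key n hn hq).choose_spec.2.1
  · intro n hn hq
    simp only [dif_pos (show n ≠ 0 ∧ (∀ q ∈ n.primeFactors, q % 3 = 2) from ⟨hn, hq⟩)]
    exact (key n hn hq).choose_spec.2.2.1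
  · intro n hn hq
    simp only [dif_pos (show n ≠ 0 ∧ (∀ q ∈ n.primeFactors, q % 3 = 2) from ⟨hn, hq⟩)]
    exact (key n hn hq).choose_spec.2.2.2

end Summit.BirchSwinnertonDyer.BirchSwinnertonDyer.Theorems.SylvesterTwoCMHalf

end
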